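import Summits.QuantumFields.YangMills.Theorems.BalabanLadderIRTwistedSlabSliceHessianDeterminant
import Literature.MathematicalPhysics.QuantumFieldTheory.Balaban1983to89.HaarWindowConstLimit
import Mathlib.Analysis.InnerProductSpace.NormDet
import HarnessLib

/-!
# The Faddeev–Popov Jacobian at the twist-eating ladders: `J(0) = √(det_ℝ Δ) · σ₀(𝔤^E)` in Frobenius-isometric frames
# (THE NUMBER's volume factor: K17's fibred chart density at the origin, read through lit-4's L26 window-constant calculus)

HELPER toward stub **T1** `TwistedSlabAnchor` (LINE `twisted-slab-continuity`, crux `IRcof` stmt-QuantumFields-26930, census row 43;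
LEAD prover ym-ir-line-tsc-p1 g4; `--supports` the crux, `--as helper`).  Sequel of K27 `…SliceHessianDeterminant` (`hsPairing`), K26
`…RealSliceDeterminant` (`suD`, `suDadj`), K17 `…FibredSliceChart` (`fibredChartDensity`, `sliceChartDensity_zero`), K16a `…ModelChart` (`modelFrame`,
`adFrame`), K15 (`slicePsiSuDeriv`, `fderiv_slicePsiSu_zero`); lit-4 L26 `HaarWindowConstLimit` (`windowConst_map_frame_comp`,
`windowConst_map_frame_comp_linearIsometryEquiv`) and Mathlib's `LinearMap.normDet` (`normDet_sq`, `normDet_eq_abs_det`) BY NAME.  Scope `Matrix.Norms.L2Operator`.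
* §1 `sPairing` — the real Frobenius pairing of site fields `Σ_x Re tr(Φ(x)ᴴ Ψ(x))` (symmetric, bi-additive); `hsPairing = Σ_μ sPairing`;
  ★ `sPairing_covLaplacian` (`⟨ΔΦ, Ψ⟩ = Σ_μ ⟨∇_μ Φ, ∇_μ Ψ⟩`, K3a summation by parts), ★ `sum_sPairing_covDeriv_eq_zero_of_mem` (`Σ_μ ⟨∇_μ Φ, a_μ⟩ = 0`
  on the real Coulomb slice: `im ∇ ⊥ ker div`), ★★ `hsPairing_slicePsiSuDeriv`: for the IFT differential `D(φ, a) = a − ∇φ` at a twist-eating ladder,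
  `⟨D(φ,a), D(φ',a')⟩ = ⟨Δφ, φ'⟩ + ⟨a, a'⟩` (the Faddeev–Popov block structure `DᵀD = Δ ⊕ 1`).
* §2 `ePairing` — the Frobenius pairing on `𝔤^E`-ambient fields `E → Matrix`; ★ `ePairing_adFrame` (`Ad(L)` and the index swap are isometric:
  `⟨adFrame v, adFrame v'⟩ = hsPairing v v'`).
* §3 `abs_det_eq_sqrt_det_of_inner_map_map` — `|det A| = √det S` when `⟪A z, A z'⟫ = ⟪S z, z'⟫` (Mathlib `normDet`).
* §4 `suPiWindowConst ι λ μ` — the window constant `σ₀ = μ(V_s) ∕ ν_s(λ)(V_s)` of B89's product exponential chart of `SU(N)^ι` (a real number);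
  ★★★ `fibredChartDensity_zero_eq_sqrt_det_mul`: at a twist-eating ladder `L = ladderField ![A, B, Γ₂, Γ₃] ∈ SU(N)^E`, for FROBENIUS-ISOMETRIC frames
  `T_M : M ≃L suFields` (`⟪p, p'⟫ = ⟨T_M p, T_M p'⟩`), `T_V : V ≃L realCoulombSlice L` (`⟪y, y'⟫ = ⟨T_V y, T_V y'⟩`) and any Frobenius-isometric reference frame
  `R : W ≃L 𝔤^E`:  `J(0) = fibredChartDensity(0) = √(det_ℝ Δ_L|_{suFields}) · σ₀(𝔤^E; vol_W ∘ R⁻¹)` — the Faddeev–Popov determinant.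
NOT here (honest scope): the product form `σ₀(𝔤^E) = σ₀(𝔤)^{|E|}` at product reference frames and the gauge-group constant `h₀` (K29), the assembly of
THE NUMBER (K30); anything uniform in `β` (M3) or in `L, t` (M4); T1-box 0∕1, T1 proper 0∕1.

HONEST FRAMING: finite-dimensional measure ∕ linear algebra at one box; nothing here bears on `IRcof`, `IR`, or the Yang–Mills mass gap (Clay: NOT proved);
R4 = `BalabanLadder.UV` only.  References: M. García Pérez, A. González-Arroyo, M. Okawa, JHEP 10 (2017) 150 §2.5 (gauge fixing, `Δ = −∇⁻∇⁺`, FP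
determinant); K. W. Breitung (1994) Thm 41; S. Helgason (2000) Ch. I §1 Thm 1.14 (13) p. 96; T. Bałaban, CMP 102 (1985) p. 260.
-/

set_option autoImplicit false

noncomputable section

open scoped Matrix Matrix.Norms.L2Operator InnerProductSpace ENNReal
open Finset Module MeasureTheory WithLp
open Literature.MathematicalPhysics.QuantumFieldTheory Literature.MathematicalPhysics.QuantumLattice
open Literature.Analysis.OperatorTheory
open Literature.MathematicalPhysics.QuantumFieldTheory.Balaban1983to89
open Literature.MathematicalPhysics.QuantumFieldTheory.Balaban1983to89.HaarExponentialChart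
open Literature.MathematicalPhysics.QuantumFieldTheory.Balaban1983to89.LogChartProduct
open Literature.MathematicalPhysics.QuantumFieldTheory.Balaban1983to89.HaarWindowConstLimit

namespace Summit.QuantumFields.YangMills.Cruxes.IRcof.TwistedSlab

variable {N : ℕ} {n₀ n₁ n₂ n₃ : ℕ}

/-! ## §1 The site pairing, the Laplacian pairing, and the Faddeev–Popov block structure `DᵀD = Δ ⊕ 1` -/

section Site

/-- The real Frobenius pairing of matrix-valued site fields: `⟨Φ, Ψ⟩ = Σ_x Re tr(Φ(x)ᴴ Ψ(x))`. [folklore] -/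
def sPairing (Φ Ψ : FinTorusSite n₀ n₁ n₂ n₃ → Matrix (Fin N) (Fin N) ℂ) : ℝ :=
  ∑ x, (((Φ x)ᴴ * Ψ x).trace).re

/-- Symmetry. [folklore] -/
theorem sPairing_comm (Φ Ψ : FinTorusSite n₀ n₁ n₂ n₃ → Matrix (Fin N) (Fin N) ℂ) : sPairing Φ Ψ = sPairing Ψ Φ := by
  unfold sPairing
  refine Finset.sum_congr rfl fun x _ => ?_
  have h : ((Ψ x)ᴴ * Φ x)ᴴ = (Φ x)ᴴ * Ψ x := by rw [Matrix.conjTranspose_mul, Matrix.conjTranspose_conjTranspose]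
  rw [← h, Matrix.trace_conjTranspose, Complex.star_def, Complex.conj_re]

/-- Subtraction in the first slot. [folklore] -/
theorem sPairing_sub_left (Φ Φ' Ψ : FinTorusSite n₀ n₁ n₂ n₃ → Matrix (Fin N) (Fin N) ℂ) :
    sPairing (Φ - Φ') Ψ = sPairing Φ Ψ - sPairing Φ' Ψ := by
  simp only [sPairing, Pi.sub_apply, Matrix.conjTranspose_sub, Matrix.sub_mul, Matrix.trace_sub, Complex.sub_re, Finset.sum_sub_distrib]

/-- Subtraction in the second slot. [folklore] -/
theorem sPairing_sub_right (Φ Ψ Ψ' : FinTorusSite n₀ n₁ n₂ n₃ → Matrix (Fin N) (Fin N) ℂ) :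
    sPairing Φ (Ψ - Ψ') = sPairing Φ Ψ - sPairing Φ Ψ' := by
  rw [sPairing_comm, sPairing_sub_left, sPairing_comm Ψ, sPairing_comm Ψ']

/-- `hsPairing a a' = Σ_μ sPairing (a μ) (a' μ)`. [folklore] -/
theorem hsPairing_eq_sum_sPairing (a a' : Fin 4 → FinTorusSite n₀ n₁ n₂ n₃ → Matrix (Fin N) (Fin N) ℂ) :
    hsPairing a a' = ∑ μ, sPairing (a μ) (a' μ) := rfl

variable {U : FinTorusSite n₀ n₁ n₂ n₃ × Fin 4 → Matrix (Fin N) (Fin N) ℂ}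

/-- ★ **The Laplacian pairing** `⟨ΔΦ, Ψ⟩ = Σ_μ ⟨∇⁺_μ Φ, ∇⁺_μ Ψ⟩` for the real covariant Laplacian on `suFields` (K3a `sum_hsRe_covDerivAdj`).
[cite: GarciaperezGonzalezarroyoOkawa2017, §2.5] -/
theorem sPairing_covLaplacian (hU : ∀ e, U e ∈ Matrix.unitaryGroup (Fin N) ℂ) (Φ Ψ : suFields N n₀ n₁ n₂ n₃) :
    sPairing ((DiscreteWeitzenboeck.covLaplacian (suD hU) (suDadj hU) Φ : suFields N n₀ n₁ n₂ n₃) : FinTorusSite n₀ n₁ n₂ n₃ → Matrix (Fin N) (Fin N) ℂ)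
        (Ψ : FinTorusSite n₀ n₁ n₂ n₃ → Matrix (Fin N) (Fin N) ℂ) =
      ∑ μ, sPairing (covDeriv U μ (Φ : FinTorusSite n₀ n₁ n₂ n₃ → Matrix (Fin N) (Fin N) ℂ))
        (covDeriv U μ (Ψ : FinTorusSite n₀ n₁ n₂ n₃ → Matrix (Fin N) (Fin N) ℂ)) := by
  have hpt : ∀ x, (((DiscreteWeitzenboeck.covLaplacian (suD hU) (suDadj hU) Φ : suFields N n₀ n₁ n₂ n₃) :
      FinTorusSite n₀ n₁ n₂ n₃ → Matrix (Fin N) (Fin N) ℂ) x) =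
      ∑ μ, (covShiftAdj U μ (covDeriv U μ (Φ : FinTorusSite n₀ n₁ n₂ n₃ → Matrix (Fin N) (Fin N) ℂ)) x -
        covDeriv U μ (Φ : FinTorusSite n₀ n₁ n₂ n₃ → Matrix (Fin N) (Fin N) ℂ) x) := by
    intro x
    rw [DiscreteWeitzenboeck.covLaplacian_apply, Submodule.coe_sum, Finset.sum_apply]
    rfl
  unfold sPairing
  simp only [hpt, Matrix.conjTranspose_sum, Finset.sum_mul, Matrix.trace_sum, Complex.re_sum]
  rw [Finset.sum_comm]
  exact Finset.sum_congr rfl fun μ _ => sum_hsRe_covDerivAdj hU μ _ _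

/-- ★ **`im ∇ ⊥ ker div`**: `Σ_μ ⟨∇⁺_μ Φ, a_μ⟩ = ⟨Φ, div a⟩ = 0` for `a` in the real Coulomb slice. [cite: GarciaperezGonzalezarroyoOkawa2017, §2.5] -/
theorem sum_sPairing_covDeriv_eq_zero_of_mem (hU : ∀ e, U e ∈ Matrix.unitaryGroup (Fin N) ℂ) (Φ : FinTorusSite n₀ n₁ n₂ n₃ → Matrix (Fin N) (Fin N) ℂ)
    {a : Fin 4 → FinTorusSite n₀ n₁ n₂ n₃ → Matrix (Fin N) (Fin N) ℂ} (ha : a ∈ realCoulombSlice U) :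
    ∑ μ, sPairing (covDeriv U μ Φ) (a μ) = 0 := by
  have h1 : ∀ μ, sPairing (covDeriv U μ Φ) (a μ) = ∑ x, (((covShiftAdj U μ (a μ) x - a μ x)ᴴ * Φ x).trace).re := by
    intro μ
    rw [sPairing_comm, sum_hsRe_covDerivAdj hU μ (a μ) Φ]
    rfl
  simp only [h1]
  rw [Finset.sum_comm]
  refine Finset.sum_eq_zero fun x _ => ?_
  have h2 : ∑ μ, (((covShiftAdj U μ (a μ) x - a μ x)ᴴ * Φ x).trace).re = (((covDiv U a x)ᴴ * Φ x).trace).re := by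
    simp only [covDiv, Matrix.conjTranspose_sum, Finset.sum_mul, Matrix.trace_sum, Complex.re_sum]
  rw [h2, covDiv_of_mem_realCoulombSlice ha x, Matrix.conjTranspose_zero, Matrix.zero_mul, Matrix.trace_zero, Complex.zero_re]

end Site

section Block

variable [NeZero N] {m n₂' n₃' : ℕ} {A B : Matrix (Fin N) (Fin N) ℂ} {ω : ℂ} {Γ₂ Γ₃ : Matrix (Fin N) (Fin N) ℂ}

/-- ★★ **THE FADDEEV–POPOV BLOCK STRUCTURE `DᵀD = Δ ⊕ 1`**: for the IFT differential `D(φ, a) = a − ∇⁺φ` of the slice chart at a twist-eating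
ladder (K15 `slicePsiSuDeriv`), `⟨D(φ, a), D(φ', a')⟩ = ⟨Δφ, φ'⟩ + ⟨a, a'⟩` (the cross terms vanish because `im ∇ ⊥ ker div`).
[cite: GarciaperezGonzalezarroyoOkawa2017, §2.5] -/
theorem hsPairing_slicePsiSuDeriv (hAu : A ∈ Matrix.unitaryGroup (Fin N) ℂ) (hBu : B ∈ Matrix.unitaryGroup (Fin N) ℂ) (hω : IsPrimitiveRoot ω N)
    (hAB : A * B = ω • (B * A)) (hNm : 2 ≤ N * (m + 1))
    (hL : ∀ e, ladderField (n₀ := m + 1) (n₁ := m + 1) (n₂ := n₂') (n₃ := n₃') ![A, B, Γ₂, Γ₃] e ∈ Matrix.specialUnitaryGroup (Fin N) ℂ)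
    (q q' : suFields N (m + 1) (m + 1) n₂' n₃' × realCoulombSlice (ladderField (n₀ := m + 1) (n₁ := m + 1) (n₂ := n₂') (n₃ := n₃') ![A, B, Γ₂, Γ₃])) :
    hsPairing (fun μ => ((slicePsiSuDeriv hAu hBu hω hAB hNm hL q μ : suFields N (m + 1) (m + 1) n₂' n₃') :
        FinTorusSite (m + 1) (m + 1) n₂' n₃' → Matrix (Fin N) (Fin N) ℂ))
      (fun μ => ((slicePsiSuDeriv hAu hBu hω hAB hNm hL q' μ : suFields N (m + 1) (m + 1) n₂' n₃') :
        FinTorusSite (m + 1) (m + 1) n₂' n₃' → Matrix (Fin N) (Fin N) ℂ)) =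
      sPairing ((DiscreteWeitzenboeck.covLaplacian (suD fun e => (Matrix.mem_specialUnitaryGroup_iff.1 (hL e)).1)
          (suDadj fun e => (Matrix.mem_specialUnitaryGroup_iff.1 (hL e)).1) q.1 : suFields N (m + 1) (m + 1) n₂' n₃') :
          FinTorusSite (m + 1) (m + 1) n₂' n₃' → Matrix (Fin N) (Fin N) ℂ)
        (q'.1 : FinTorusSite (m + 1) (m + 1) n₂' n₃' → Matrix (Fin N) (Fin N) ℂ) +
      hsPairing (q.2 : Fin 4 → FinTorusSite (m + 1) (m + 1) n₂' n₃' → Matrix (Fin N) (Fin N) ℂ)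
        (q'.2 : Fin 4 → FinTorusSite (m + 1) (m + 1) n₂' n₃' → Matrix (Fin N) (Fin N) ℂ) := by
  have hLu : ∀ e, ladderField (n₀ := m + 1) (n₁ := m + 1) (n₂ := n₂') (n₃ := n₃') ![A, B, Γ₂, Γ₃] e ∈ Matrix.unitaryGroup (Fin N) ℂ :=
    fun e => (Matrix.mem_specialUnitaryGroup_iff.1 (hL e)).1
  have hD : ∀ (r : suFields N (m + 1) (m + 1) n₂' n₃' × realCoulombSlice (ladderField (n₀ := m + 1) (n₁ := m + 1) (n₂ := n₂') (n₃ := n₃') ![A, B, Γ₂, Γ₃]))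
      (μ : Fin 4), ((slicePsiSuDeriv hAu hBu hω hAB hNm hL r μ : suFields N (m + 1) (m + 1) n₂' n₃') :
        FinTorusSite (m + 1) (m + 1) n₂' n₃' → Matrix (Fin N) (Fin N) ℂ) =
      (r.2 : Fin 4 → FinTorusSite (m + 1) (m + 1) n₂' n₃' → Matrix (Fin N) (Fin N) ℂ) μ -
        covDeriv (ladderField (n₀ := m + 1) (n₁ := m + 1) (n₂ := n₂') (n₃ := n₃') ![A, B, Γ₂, Γ₃]) μ
          (r.1 : FinTorusSite (m + 1) (m + 1) n₂' n₃' → Matrix (Fin N) (Fin N) ℂ) := by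
    intro r μ
    rw [coe_slicePsiSuDeriv_apply]
    rfl
  rw [hsPairing_eq_sum_sPairing, hsPairing_eq_sum_sPairing, sPairing_covLaplacian hLu]
  simp only [hD, sPairing_sub_left, sPairing_sub_right, Finset.sum_sub_distrib]
  have h0 : ∑ μ, sPairing (covDeriv (ladderField (n₀ := m + 1) (n₁ := m + 1) (n₂ := n₂') (n₃ := n₃') ![A, B, Γ₂, Γ₃]) μ
      (q.1 : FinTorusSite (m + 1) (m + 1) n₂' n₃' → Matrix (Fin N) (Fin N) ℂ))
      ((q'.2 : Fin 4 → FinTorusSite (m + 1) (m + 1) n₂' n₃' → Matrix (Fin N) (Fin N) ℂ) μ) = 0 :=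
    sum_sPairing_covDeriv_eq_zero_of_mem hLu _ q'.2.2
  have h0' : ∑ μ, sPairing ((q.2 : Fin 4 → FinTorusSite (m + 1) (m + 1) n₂' n₃' → Matrix (Fin N) (Fin N) ℂ) μ)
      (covDeriv (ladderField (n₀ := m + 1) (n₁ := m + 1) (n₂ := n₂') (n₃ := n₃') ![A, B, Γ₂, Γ₃]) μ
        (q'.1 : FinTorusSite (m + 1) (m + 1) n₂' n₃' → Matrix (Fin N) (Fin N) ℂ)) = 0 := by
    rw [← sum_sPairing_covDeriv_eq_zero_of_mem hLu (q'.1 : FinTorusSite (m + 1) (m + 1) n₂' n₃' → Matrix (Fin N) (Fin N) ℂ) q.2.2]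
    exact Finset.sum_congr rfl fun μ _ => sPairing_comm _ _
  rw [h0, h0']
  ring

end Block

/-! ## §2 The Frobenius pairing on `𝔤^E` and the isometry `adFrame` -/

section EPairing

/-- The real Frobenius pairing of `E`-indexed matrix fields: `⟨X, X'⟩ = Σ_e Re tr(X(e)ᴴ X'(e))`. [folklore] -/
def ePairing {E : Type*} [Fintype E] (X X' : E → Matrix (Fin N) (Fin N) ℂ) : ℝ :=
  ∑ e, (((X e)ᴴ * X' e).trace).re

variable {L : FinTorusSite n₀ n₁ n₂ n₃ × Fin 4 → Matrix (Fin N) (Fin N) ℂ}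

/-- `Re tr((Lᴴ V₁ L)ᴴ (Lᴴ V₂ L)) = Re tr(V₁ᴴ V₂)` for `L Lᴴ = 1`. [folklore] -/
private theorem re_trace_conj_mul_conj {Lx V₁ V₂ : Matrix (Fin N) (Fin N) ℂ} (hLL : Lx * Lxᴴ = 1) :
    (((Lxᴴ * V₁ * Lx)ᴴ * (Lxᴴ * V₂ * Lx)).trace).re = ((V₁ᴴ * V₂).trace).re := by
  rw [Matrix.conjTranspose_mul, Matrix.conjTranspose_mul, Matrix.conjTranspose_conjTranspose]
  have h : Lxᴴ * (V₁ᴴ * Lx) * (Lxᴴ * V₂ * Lx) = Lxᴴ * (V₁ᴴ * V₂) * Lx := by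
    calc Lxᴴ * (V₁ᴴ * Lx) * (Lxᴴ * V₂ * Lx) = Lxᴴ * V₁ᴴ * (Lx * Lxᴴ) * V₂ * Lx := by simp only [Matrix.mul_assoc]
      _ = Lxᴴ * (V₁ᴴ * V₂) * Lx := by rw [hLL, Matrix.mul_one]; simp only [Matrix.mul_assoc]
  rw [h, Matrix.trace_mul_cycle, hLL, Matrix.one_mul]

/-- ★ **`adFrame` is Frobenius-isometric** (conjugation by the unitary background and the index swap `(μ, x) ↔ (x, μ)`):
`⟨adFrame v, adFrame v'⟩ = hsPairing v v'`. [cite: Helgason2000, Ch. I §1 Thm 1.14 p. 96] -/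
theorem ePairing_adFrame [NeZero N] (hL : ∀ e, L e ∈ Matrix.unitaryGroup (Fin N) ℂ) (v v' : Fin 4 → suFields N n₀ n₁ n₂ n₃) :
    ePairing ((adFrame hL v : (piLogChart (specialUnitaryLogChart (Fin N)) (FinTorusSite n₀ n₁ n₂ n₃ × Fin 4)).lie) :
        FinTorusSite n₀ n₁ n₂ n₃ × Fin 4 → Matrix (Fin N) (Fin N) ℂ)
      ((adFrame hL v' : (piLogChart (specialUnitaryLogChart (Fin N)) (FinTorusSite n₀ n₁ n₂ n₃ × Fin 4)).lie) :
        FinTorusSite n₀ n₁ n₂ n₃ × Fin 4 → Matrix (Fin N) (Fin N) ℂ) =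
      hsPairing (fun μ => ((v μ : suFields N n₀ n₁ n₂ n₃) : FinTorusSite n₀ n₁ n₂ n₃ → Matrix (Fin N) (Fin N) ℂ))
        (fun μ => ((v' μ : suFields N n₀ n₁ n₂ n₃) : FinTorusSite n₀ n₁ n₂ n₃ → Matrix (Fin N) (Fin N) ℂ)) := by
  unfold ePairing hsPairing
  rw [Finset.sum_comm, ← Finset.univ_product_univ, Finset.sum_product]
  refine Finset.sum_congr rfl fun x _ => Finset.sum_congr rfl fun μ _ => ?_
  simp only [coe_adFrame_apply]
  exact re_trace_conj_mul_conj (hL (x, μ)).2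

end EPairing

/-! ## §3 `|det A| = √(det S)` when `AᵀA = S` -/

section Det

variable {W : Type*} [NormedAddCommGroup W] [InnerProductSpace ℝ W] [FiniteDimensional ℝ W]

/-- `|det A| = √det S` for endomorphisms `A, S` of a Euclidean space with `⟪A z, A z'⟫ = ⟪S z, z'⟫` (`AᵀA = S`; Mathlib `LinearMap.normDet`).
[cite: Breitung1994, Thm 41] -/
theorem abs_det_eq_sqrt_det_of_inner_map_map (T S : W →ₗ[ℝ] W) (h : ∀ z z' : W, ⟪T z, T z'⟫_ℝ = ⟪S z, z'⟫_ℝ) :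
    |LinearMap.det T| = Real.sqrt (LinearMap.det S) := by
  have hTS : T.adjoint ∘ₗ T = S := by
    refine LinearMap.ext fun z => ext_inner_right ℝ fun z' => ?_
    rw [LinearMap.comp_apply, LinearMap.adjoint_inner_left, h]
  have hsq : T.normDet ^ 2 = LinearMap.det S := by
    have h1 := T.normDet_sq
    rw [hTS] at h1
    exact_mod_cast h1
  rw [← LinearMap.normDet_eq_abs_det, ← hsq, Real.sqrt_sq (LinearMap.normDet_nonneg _)]

end Det

/-! ## §4 The window constant of `SU(N)^ι` and the Faddeev–Popov Jacobian `J(0) = √(det_ℝ Δ) · σ₀(𝔤^E)` -/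

section Window

/-- **The window constant** `σ₀(SU(N)^ι; λ; μ) = μ(V_s) ∕ ν_s(λ)(V_s)` of B89's product exponential chart of `SU(N)^ι` at its chart radius, for a reference
measure `λ` on `𝔤^ι` (Borel σ-algebra) and a measure `μ` on `SU(N)^ι` — as a real number. [cite: Helgason2000, Ch. I §1 Thm 1.14 (13) p. 96]
[cite: Balaban1985UV3, p. 260] -/
def suPiWindowConst (ι : Type*) [Fintype ι] [NeZero N]
    (lam : @Measure (piLogChart (specialUnitaryLogChart (Fin N)) ι).lie (borel _))
    (μ : Measure (ι → Matrix.specialUnitaryGroup (Fin N) ℂ)) : ℝ :=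
  letI : MeasurableSpace (piLogChart (specialUnitaryLogChart (Fin N)) ι).lie := borel _
  (μ ((isChartRep_pi ι (isChartRep_specialUnitaryGroup (n := Fin N))).window
        (IsChartRep.chartRadius (piLogChart (specialUnitaryLogChart (Fin N)) ι))) /
      (isChartRep_pi ι (isChartRep_specialUnitaryGroup (n := Fin N))).chartMeasure
        (lie_adStable_pi (specialUnitaryLogChart (Fin N)) ι (lie_adStable_specialUnitaryGroup (n := Fin N))) lam
        (IsChartRep.chartRadius (piLogChart (specialUnitaryLogChart (Fin N)) ι))
        ((isChartRep_pi ι (isChartRep_specialUnitaryGroup (n := Fin N))).window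
          (IsChartRep.chartRadius (piLogChart (specialUnitaryLogChart (Fin N)) ι)))).toReal

end Window

section Jacobian

variable [NeZero N] {m n₂' n₃' : ℕ} {A B : Matrix (Fin N) (Fin N) ℂ} {ω : ℂ} {Γ₂ Γ₃ : Matrix (Fin N) (Fin N) ℂ}
variable {M : Type*} [NormedAddCommGroup M] [InnerProductSpace ℝ M] [FiniteDimensional ℝ M] [MeasurableSpace M] [BorelSpace M]
variable {V : Type*} [NormedAddCommGroup V] [InnerProductSpace ℝ V] [FiniteDimensional ℝ V] [MeasurableSpace V] [BorelSpace V]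
variable {W : Type*} [NormedAddCommGroup W] [InnerProductSpace ℝ W] [FiniteDimensional ℝ W] [MeasurableSpace W] [BorelSpace W]
set_option maxHeartbeats 400000 in
/-- ★★★ **THE FADDEEV–POPOV JACOBIAN** `J(0) = √(det_ℝ Δ) · σ₀(𝔤^E)`: at a twist-eating ladder `L = ladderField ![A, B, Γ₂, Γ₃] ∈ SU(N)^E` (box
`(m+1)² × n₂' × n₃'`, `N(m+1) ≥ 2`), for Frobenius-isometric frames `T_M` of `suFields`, `T_V` of the real Coulomb slice, and any Frobenius-isometric
reference frame `R : W ≃L 𝔤^E`, K17's fibred chart density at the origin is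
`fibredChartDensity(0) = √(det_ℝ (Δ_L|_{suFields})) · σ₀(SU(N)^E; vol_W ∘ R⁻¹; μ)`:
the model frame is `(R ∘ ι) ∘ A` with `ι` a linear isometry and `AᵀA = T⁻¹(Δ ⊕ 1)T` (§1–§3), and `σ₀` transforms by `|det A|` (lit-4 L26).
[cite: GarciaperezGonzalezarroyoOkawa2017, §2.5] [cite: Breitung1994, Thm 41] [cite: Helgason2000, Ch. I §1 Thm 1.14 (13) p. 96] -/
theorem fibredChartDensity_zero_eq_sqrt_det_mul (hAu : A ∈ Matrix.unitaryGroup (Fin N) ℂ) (hBu : B ∈ Matrix.unitaryGroup (Fin N) ℂ)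
    (hω : IsPrimitiveRoot ω N) (hAB : A * B = ω • (B * A)) (hNm : 2 ≤ N * (m + 1))
    (hL : ∀ e, ladderField (n₀ := m + 1) (n₁ := m + 1) (n₂ := n₂') (n₃ := n₃') ![A, B, Γ₂, Γ₃] e ∈ Matrix.specialUnitaryGroup (Fin N) ℂ)
    (T_M : M ≃L[ℝ] suFields N (m + 1) (m + 1) n₂' n₃')
    (hT_M : ∀ p p' : M, ⟪p, p'⟫_ℝ = sPairing ((T_M p : suFields N (m + 1) (m + 1) n₂' n₃') : FinTorusSite (m + 1) (m + 1) n₂' n₃' → Matrix (Fin N) (Fin N) ℂ)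
      ((T_M p' : suFields N (m + 1) (m + 1) n₂' n₃') : FinTorusSite (m + 1) (m + 1) n₂' n₃' → Matrix (Fin N) (Fin N) ℂ))
    (T_V : V ≃L[ℝ] realCoulombSlice (ladderField (n₀ := m + 1) (n₁ := m + 1) (n₂ := n₂') (n₃ := n₃') ![A, B, Γ₂, Γ₃]))
    (hT_V : ∀ y y' : V, ⟪y, y'⟫_ℝ = hsPairing ((T_V y : realCoulombSlice _) : Fin 4 → FinTorusSite (m + 1) (m + 1) n₂' n₃' → Matrix (Fin N) (Fin N) ℂ)
      ((T_V y' : realCoulombSlice _) : Fin 4 → FinTorusSite (m + 1) (m + 1) n₂' n₃' → Matrix (Fin N) (Fin N) ℂ))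
    (R : W ≃L[ℝ] (piLogChart (specialUnitaryLogChart (Fin N)) (FinTorusSite (m + 1) (m + 1) n₂' n₃' × Fin 4)).lie)
    (hR : ∀ w w' : W, ⟪w, w'⟫_ℝ =
      ePairing ((R w : (piLogChart (specialUnitaryLogChart (Fin N)) (FinTorusSite (m + 1) (m + 1) n₂' n₃' × Fin 4)).lie) :
          FinTorusSite (m + 1) (m + 1) n₂' n₃' × Fin 4 → Matrix (Fin N) (Fin N) ℂ)
        ((R w' : (piLogChart (specialUnitaryLogChart (Fin N)) (FinTorusSite (m + 1) (m + 1) n₂' n₃' × Fin 4)).lie) :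
          FinTorusSite (m + 1) (m + 1) n₂' n₃' × Fin 4 → Matrix (Fin N) (Fin N) ℂ))
    (μ : Measure (FinTorusSite (m + 1) (m + 1) n₂' n₃' × Fin 4 → Matrix.specialUnitaryGroup (Fin N) ℂ)) :
    letI : MeasurableSpace (piLogChart (specialUnitaryLogChart (Fin N)) (FinTorusSite (m + 1) (m + 1) n₂' n₃' × Fin 4)).lie := borel _
    fibredChartDensity hL (slicePsiSuDeriv hAu hBu hω hAB hNm hL) (prodFrame T_M T_V) μ 0 =
      Real.sqrt (LinearMap.det (DiscreteWeitzenboeck.covLaplacian (suD fun e => (Matrix.mem_specialUnitaryGroup_iff.1 (hL e)).1)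
          (suDadj fun e => (Matrix.mem_specialUnitaryGroup_iff.1 (hL e)).1))) *
        suPiWindowConst (FinTorusSite (m + 1) (m + 1) n₂' n₃' × Fin 4) ((volume : Measure W).map R) μ := by
  letI : MeasurableSpace (piLogChart (specialUnitaryLogChart (Fin N)) (FinTorusSite (m + 1) (m + 1) n₂' n₃' × Fin 4)).lie := borel _
  haveI : BorelSpace (piLogChart (specialUnitaryLogChart (Fin N)) (FinTorusSite (m + 1) (m + 1) n₂' n₃' × Fin 4)).lie := ⟨rfl⟩
  haveI : FiniteDimensional ℝ (piLogChart (specialUnitaryLogChart (Fin N)) (FinTorusSite (m + 1) (m + 1) n₂' n₃' × Fin 4)).lie :=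
    finiteDimensional_piLogChart_lie _ _
  have hLu : ∀ e, ladderField (n₀ := m + 1) (n₁ := m + 1) (n₂ := n₂') (n₃ := n₃') ![A, B, Γ₂, Γ₃] e ∈ Matrix.unitaryGroup (Fin N) ℂ :=
    fun e => (Matrix.mem_specialUnitaryGroup_iff.1 (hL e)).1
  -- abbreviations
  set D := slicePsiSuDeriv hAu hBu hω hAB hNm hL with hDdef
  set T := prodFrame T_M T_V with hTdef
  set Δ := DiscreteWeitzenboeck.covLaplacian (suD hLu) (suDadj hLu) with hΔdef
  -- Step 1: `J(0) = σ₀(vol ∘ modelFrame⁻¹)` (K17)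
  have h1 : fibredChartDensity hL D T μ 0 = sliceChartDensity hL D T μ 0 := by
    show sliceChartDensity hL D T μ (toLp 2 0) = _
    rw [WithLp.toLp_zero]
  rw [h1, sliceChartDensity_zero hL D T (fderiv_slicePsiSu_zero hAu hBu hω hAB hNm hL) μ]
  -- Step 2: the linear isometry `ι : V' ≃ W` and the automorphism `A = ι⁻¹ R⁻¹ ∘ modelFrame`
  have hfin : finrank ℝ (WithLp 2 (M × V)) = finrank ℝ W :=
    (modelFrame hLu D T).toLinearEquiv.finrank_eq.trans R.toLinearEquiv.finrank_eq.symm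
  set ι : WithLp 2 (M × V) ≃ₗᵢ[ℝ] W := (stdOrthonormalBasis ℝ (WithLp 2 (M × V))).equiv (stdOrthonormalBasis ℝ W) (finCongr hfin) with hιdef
  set Aut : WithLp 2 (M × V) ≃L[ℝ] WithLp 2 (M × V) := ((modelFrame hLu D T).trans R.symm).trans ι.toContinuousLinearEquiv.symm with hAutdef
  set e : WithLp 2 (M × V) ≃L[ℝ] (piLogChart (specialUnitaryLogChart (Fin N)) (FinTorusSite (m + 1) (m + 1) n₂' n₃' × Fin 4)).lie :=
    ι.toContinuousLinearEquiv.trans R with hedef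
  have hcomp : (fun v => e (Aut v)) = fun v => modelFrame hLu D T v := by
    funext v
    simp only [hedef, hAutdef, ContinuousLinearEquiv.trans_apply, LinearIsometryEquiv.coe_toContinuousLinearEquiv,
      LinearIsometryEquiv.coe_symm_toContinuousLinearEquiv, LinearIsometryEquiv.apply_symm_apply, ContinuousLinearEquiv.apply_symm_apply]
  have hmap : (volume : Measure (WithLp 2 (M × V))).map (modelFrame hLu D T) = (volume : Measure (WithLp 2 (M × V))).map fun v => e (Aut v) := by
    rw [hcomp]
  have he : (volume : Measure (WithLp 2 (M × V))).map e = (volume : Measure (WithLp 2 (M × V))).map fun w => R (ι w) := rfl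
  -- Step 3: `AᵀA = S := T'⁻¹ (Δ_M ⊕ 1) T'`, `|det A| = √det Δ`
  set ΔM : M →ₗ[ℝ] M := T_M.toLinearEquiv.symm.conj Δ with hΔMdef
  set S : WithLp 2 (M × V) →ₗ[ℝ] WithLp 2 (M × V) := (WithLp.linearEquiv 2 ℝ (M × V)).symm.conj (ΔM.prodMap (LinearMap.id : V →ₗ[ℝ] V)) with hSdef
  have hdetΔM : LinearMap.det ΔM = LinearMap.det Δ := by
    rw [hΔMdef, LinearEquiv.conj_apply, LinearMap.comp_assoc, LinearMap.det_conj]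
  have hdetS : LinearMap.det S = LinearMap.det Δ := by
    rw [hSdef, LinearEquiv.conj_apply, LinearMap.comp_assoc, LinearMap.det_conj, LinearMap.det_prodMap, LinearMap.det_id, mul_one, hdetΔM]
  have hS_apply : ∀ z : WithLp 2 (M × V), S z = toLp 2 (ΔM (ofLp z).1, (ofLp z).2) := fun z => rfl
  have hΔM : ∀ p : M, T_M (ΔM p) = Δ (T_M p) := fun p => by
    rw [hΔMdef, LinearEquiv.conj_apply]
    simp only [LinearMap.coe_comp, Function.comp_apply, LinearEquiv.coe_coe, LinearEquiv.symm_symm, ContinuousLinearEquiv.coe_toLinearEquiv,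
      ContinuousLinearEquiv.coe_symm_toLinearEquiv, ContinuousLinearEquiv.apply_symm_apply]
  have hinner : ∀ z z' : WithLp 2 (M × V), ⟪(Aut.toLinearEquiv : WithLp 2 (M × V) →ₗ[ℝ] WithLp 2 (M × V)) z,
      (Aut.toLinearEquiv : WithLp 2 (M × V) →ₗ[ℝ] WithLp 2 (M × V)) z'⟫_ℝ = ⟪S z, S z' - S z' + z'⟫_ℝ := by
    intro z z'
    rw [sub_self, zero_add]
    -- left side: through `ι`, `R`, `adFrame`, `D`
    have hl : ⟪(Aut.toLinearEquiv : WithLp 2 (M × V) →ₗ[ℝ] WithLp 2 (M × V)) z, (Aut.toLinearEquiv : WithLp 2 (M × V) →ₗ[ℝ] WithLp 2 (M × V)) z'⟫_ℝ =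
        hsPairing (fun ν => ((D (T z) ν : suFields N (m + 1) (m + 1) n₂' n₃') : FinTorusSite (m + 1) (m + 1) n₂' n₃' → Matrix (Fin N) (Fin N) ℂ))
          (fun ν => ((D (T z') ν : suFields N (m + 1) (m + 1) n₂' n₃') : FinTorusSite (m + 1) (m + 1) n₂' n₃' → Matrix (Fin N) (Fin N) ℂ)) := by
      have h2 : ∀ u : WithLp 2 (M × V), (Aut.toLinearEquiv : WithLp 2 (M × V) →ₗ[ℝ] WithLp 2 (M × V)) u = ι.symm (R.symm (modelFrame hLu D T u)) :=
        fun u => rfl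
      rw [h2, h2, LinearIsometryEquiv.inner_map_map, hR, ContinuousLinearEquiv.apply_symm_apply, ContinuousLinearEquiv.apply_symm_apply]
      exact ePairing_adFrame hLu (D (T z)) (D (T z'))
    rw [hl, hsPairing_slicePsiSuDeriv hAu hBu hω hAB hNm hL, WithLp.prod_inner_apply, hS_apply, WithLp.ofLp_toLp, hT_M, hT_V, hΔM]
    rfl
  have hinner' : ∀ z z' : WithLp 2 (M × V), ⟪(Aut.toLinearEquiv : WithLp 2 (M × V) →ₗ[ℝ] WithLp 2 (M × V)) z,
      (Aut.toLinearEquiv : WithLp 2 (M × V) →ₗ[ℝ] WithLp 2 (M × V)) z'⟫_ℝ = ⟪S z, z'⟫_ℝ := fun z z' => by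
    rw [hinner, sub_self, zero_add]
  have hdetA : |LinearMap.det (Aut.toLinearEquiv : WithLp 2 (M × V) →ₗ[ℝ] WithLp 2 (M × V))| = Real.sqrt (LinearMap.det Δ) := by
    rw [abs_det_eq_sqrt_det_of_inner_map_map _ S hinner', hdetS]
  -- Step 4: assemble with lit-4 L26
  rw [hmap]
  have hW := windowConst_map_frame_comp (isChartRep_pi (FinTorusSite (m + 1) (m + 1) n₂' n₃' × Fin 4) (isChartRep_specialUnitaryGroup (n := Fin N)))
    (lie_adStable_pi (specialUnitaryLogChart (Fin N)) (FinTorusSite (m + 1) (m + 1) n₂' n₃' × Fin 4) (lie_adStable_specialUnitaryGroup (n := Fin N)))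
    μ e Aut (IsChartRep.chartRadius (piLogChart (specialUnitaryLogChart (Fin N)) (FinTorusSite (m + 1) (m + 1) n₂' n₃' × Fin 4)))
  rw [hW, hdetA, he, windowConst_map_frame_comp_linearIsometryEquiv
    (isChartRep_pi (FinTorusSite (m + 1) (m + 1) n₂' n₃' × Fin 4) (isChartRep_specialUnitaryGroup (n := Fin N)))
    (lie_adStable_pi (specialUnitaryLogChart (Fin N)) (FinTorusSite (m + 1) (m + 1) n₂' n₃' × Fin 4) (lie_adStable_specialUnitaryGroup (n := Fin N))) R ι]
  congr 1

end Jacobian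

end Summit.QuantumFields.YangMills.Cruxes.IRcof.TwistedSlab

end
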